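/-
Copyright (c) 2026 the pub-hodgecm-mathlib formalisation cell (harness21).  Prover seat hodgecm-mathlib-K2E1-p16 (g2), Track B «K2-LIT» ENGINE E1, h413 = `stmt-HodgeConjecture-24833`,
route `HCCMUnconditional`, R90-S8 «ContSpec-n½» #2∕#3 chain, deal S8-R72 (3) (S8 dealer R90-CS-plan (g2)): T-hr2-1 — THE MIDDLE-POLE RESIDUE OF THE CONTINUED χ-EISENSTEIN FAMILY
OF `U(2,1)` ON THE SIEGEL TOP (constant term depending on `g` through the SECTION), and T-hr2-2 «of letters» (the `L²` residue from the Maass–Selberg bound at the pole).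
-/
import Summits.HodgeConjecture.HodgeConjecture.Theorems.K2E1ContinuedEisensteinResidueFunctionUThree   -- ★ (K2E4-p10) the height-only, pole-`2` TEMPLATE; brings its ★ Siegel inputs (`truncation_rational_mul`, `truncation_eq_self_sub_borelConstantTerm_of_rational_invariant`, BL-R1₃, R6e)
import Summits.HodgeConjecture.HodgeConjecture.Theorems.K2E1SphericalEisensteinL2ResidueCMTwo          -- ★ (K2E1-p12) §1 Banach residue brick `exists_tendsto_sub_smul_of_differentiableOn` (generic pole)
import HarnessLib

/-!
# h413 ∕ R90-S8, T-hr2-1 (+ T-hr2-2 «of letters») — `K2E1ChiContinuedEisensteinMiddleResidueCMThree`: THE RESIDUE OF THE CONTINUED χ-EISENSTEIN FAMILY OF `U(J₃)` AT ANY POLE, ON THE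
# SIEGEL TOP — Siegel-top formula AT THE MAXIMISER, the pointwise limit `(z−z₀)·Λ^T Ẽ_χ(z)(y) → r(y) − 𝟙[T < w(y)]·ρψ(γ₀y)·H(γ₀y)^{2−z₀}`, the a.e. identification of the `L²`
# residue class, and its existence from the Maass–Selberg bound at `z₀`

Cell `pub/hodgecm-mathlib`, crux H413 = `stmt-HodgeConjecture-24833`; S8 dealer R90-CS-plan (g2) S8-R72 (3); census `K2/K2E1-p16/g2/CENSUS-MidRes.md`.  Consumers: R90-C133-p02's `hr2` road
(`Theorems/K2E1ChiEisensteinMiddleResidueMemL2CMThree`, letters `hRes`∕`hId`∕`hTail`, `r g := Fp g z₀`, `quotFun r x = Fp (out x)⁻¹ z₀` by `rfl`) and K2E2-p12's ★ (NV)-rep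
`R90S8ResGMidResidueClassNeZeroU3` (generic pole `z₀`).  THEOREMS ONLY (no `def`, no `instance`, no notation, no named-fact hypothesis, no `sorry`); lane
`--supports stmt-HodgeConjecture-24833 --as helper` (count-neutral).  Generic CM-type extension `E/F` (`F E c`), rank-one `U(J₃)` (the Siegel inputs are `N = 3`).

THE MATHEMATICS ([MoeglinWaldspurger1995, I.2.13, IV.1.11]; [Langlands1976, §7]; [Arthur1980TraceFormulaII, §1]).  The ★ template `K2E1ContinuedEisensteinResidueFunctionUThree` treats a constant term
that is a function of the HEIGHT only (`u_B(g) = Φ(H(g))`, spherical family) and hard-wires the pole at `2`.  For the χ-family the continued constant term is SECTION-dependent,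
`Ẽ_χ(z)_B(g) = φ(g)·H(g)^z + ψ_z(g)·H(g)^{2−z}` (`hE3`, the `N = 3` twin of T2 FINAL's shape; ★ `borelConstantTerm_chiPairEisenstein_cm_three_eq_add_mul` on `Re z > 2`), and the poles of
interest are the TOP `z₀ = 2` and the MIDDLE `z₀ = 3∕2`.  Above the floor (`T ≥ 1`) the Siegel top of `y` is ONE `B(F)`-coset `γ₀y` (`H(γ₀y) = max_γ H(γy)`, attained — ★ BL-R1₃), and for ANY
left-`G(F)`-invariant `u`: **`Λ^T u(y) = u(y) − 𝟙[T < H(γ₀y)]·u_B(γ₀y)`** (§1; all ★ inputs are generic in `u`).  Hence at a simple pole `z₀` (`(z−z₀)Ẽ(z)(g) → r(g) = Fp g z₀`, pole letter;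
`(z−z₀)ψ_z(g) → ρψ(g)`, the residue letter of the intertwined part): **`(z−z₀)·Λ^T Ẽ_χ(z)(y) → r(y) − 𝟙[T < H(γ₀y)]·ρψ(γ₀y)·H(γ₀y)^{2−z₀}`** (§2), so the `L²` residue class `Res_T` of the truncated
family — which EXISTS as soon as `‖(z−z₀)•F_T(z)‖` is bounded near `z₀` (Maass–Selberg at `z₀`; ★ Banach brick) — is `r − tail_T` a.e. (§3–§4).  The maximiser enters the statements as a
hypothesis-first SELECTOR `(γ₀ : G(𝔸) → Γ) (hγ₀ : ∀ y δ, H(δy) ≤ H(γ₀ y · y))` (consumer: `Classical.choose` of ★ `exists_forall_borelHeight_mul_le`); the indicator is spelled with the choice-free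
★ `supHeight`.  Middle pole: `2 − z₀ = ½`, tail `∝ H^{½}·𝟙[T < w₁]` — `L²` on the cusp by the exponent criterion `τ = 1 < 2` (R90-C133-p02's §2).
* §1 **`truncation_apply_of_isMax`** — the Siegel-top formula AT THE MAXIMISER.
* §2 **`tendsto_sub_mul_truncation_continued_of_section`** — the pointwise limit at any pole `z₀`.
* §3 **`ae_eq_residueValue_sub_section_indicator`** — `Res_T =ᵐ (x ↦ Fp x̃⁻¹ z₀ − tail_T x)`; `quotFun_residue_ae_eq_add_tail` — the `hId` spelling `quotFun r =ᵐ Res_T + tail_T`.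
* §4 **`exists_L2Residue_of_section`** — T-hr2-2 MODULO the (MS) bound `hMS : ∃ C, ∀ᶠ z in 𝓝[≠] z₀, ‖(z − z₀)•F_T z‖ ≤ C` (its payer, the χ-twin of ★ `ms2_of_road`, is NOT in this file).
HONEST LABEL: HC_CM is proved only modulo the 7 printed citations (2 remaining named inputs: hLiu418 = `stmt-HodgeConjecture-24832`, h413 = `stmt-HodgeConjecture-24833`) until rung 0
closes; this file asserts no named fact and closes no socket; its heads are CONDITIONAL on the visible letters `hEcinv`, `hE3`, `hψ`, the pole letter `(Fp, hF, hFE)`, the operator road's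
`(Fam, hFam)` and (§4) `hFd`, `hMS`; count-neutral.

## References
* [MoeglinWaldspurger1995] C. Mœglin, J.-L. Waldspurger, *Spectral Decomposition and Eisenstein Series* (1995), I.2.13, IV.1.9–IV.1.11.
* [Langlands1976] R. P. Langlands, *On the Functional Equations Satisfied by Eisenstein Series*, LNM 544 (1976), §7.
* [Arthur1980TraceFormulaII] J. Arthur, *A trace formula for reductive groups II*, Compositio Math. 40 (1980), §1 (the truncation operator).
* [BernsteinLapid2019] J. Bernstein, E. Lapid, *On the meromorphic continuation of Eisenstein series*, J. Amer. Math. Soc. 37 (2024), §4 p. 10.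
-/

set_option autoImplicit false
-- the mandated namespace repeats the single-problem summit's segment (`HodgeConjecture.HodgeConjecture`)
set_option linter.dupNamespace false

noncomputable section

open MeasureTheory Measure NumberField IsDedekindDomain Set Filter Topology Metric
open scoped ENNReal NNReal
open Literature.NumberTheory.Automorphic Literature.NumberTheory.Automorphic.UnitaryGroup AdelicGroupData
open Summit.HodgeConjecture.HodgeConjecture.Cruxes.H413.K2E1BLBorelSpacesU2Defs
open Summit.HodgeConjecture.HodgeConjecture.Cruxes.H413.K2E1BLEisensteinInWeightedSpaceU2Weights (supHeight_eq_ciSup_arithmetic)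
open Summit.HodgeConjecture.HodgeConjecture.Cruxes.H413.K2E1BLHeckeOperatorWeightedU2 (bddAbove_range_borelHeight_arith_mul)
open Summit.HodgeConjecture.HodgeConjecture.Cruxes.H413.K2E1TruncatedEisensteinL2 (truncation_apply_eq_self_of_forall_borelHeight_le)
open Summit.HodgeConjecture.HodgeConjecture.Cruxes.H413.K2E1SphericalEisensteinL2ResidueCMTwo (exists_tendsto_sub_smul_of_differentiableOn)

namespace Summit.HodgeConjecture.HodgeConjecture.Cruxes.H413.K2E1ChiContinuedEisensteinMiddleResidueCMThree

variable {F E : Type} [Field F] [NumberField F] [Field E] [NumberField E] [Algebra F E] {c : E ≃ₐ[F] E}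
variable [MeasurableSpace (quasiSplit F E c 3).Adelic] [BorelSpace (quasiSplit F E c 3).Adelic]

/-! ## §1 The Siegel-top formula at the maximiser -/

/-- **THE SIEGEL-TOP FORMULA AT THE MAXIMISER**: for `T ≥ 1`, a left-`G(F)`-invariant `u`, a point `y` and `γ₀ ∈ G(F)` maximising `γ ↦ H(γy)` (★ BL-R1₃: a maximiser exists):
`Λ^T u(y) = u(y) − 𝟙[T < H(γ₀y)]·u_B(γ₀y)` — above the floor only the top coset contributes (★ `truncation_eq_self_sub_borelConstantTerm_of_rational_invariant` at `γ₀y`, ★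
`truncation_rational_mul`), below it nothing does (★ `truncation_apply_eq_self_of_forall_borelHeight_le`).  No hypothesis on the SHAPE of the constant term.
[cite: MoeglinWaldspurger1995, I.2.13] [cite: Arthur1980TraceFormulaII, §1] -/
theorem truncation_apply_of_isMax (ν : Measure ↥(adelicUnipotent F E c 3)) [ν.IsHaarMeasure] {𝓕 : Set ↥(adelicUnipotent F E c 3)}
    (h𝓕 : IsFundamentalDomain ↥(rationalUnipotent F E c 3) 𝓕 ν) {T : ℝ≥0} (hT : 1 ≤ T) {u : (quasiSplit F E c 3).Adelic → ℂ}
    (hu : ∀ (γ : (quasiSplit F E c 3).arithmeticSubgroup) (x : (quasiSplit F E c 3).Adelic), u ((γ : (quasiSplit F E c 3).Adelic) * x) = u x)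
    (y : (quasiSplit F E c 3).Adelic) (γ₀ : (quasiSplit F E c 3).arithmeticSubgroup)
    (hγ₀ : ∀ δ : (quasiSplit F E c 3).arithmeticSubgroup, borelHeight ((δ : (quasiSplit F E c 3).Adelic) * y) ≤ borelHeight ((γ₀ : (quasiSplit F E c 3).Adelic) * y)) :
    truncation ν 𝓕 T u y = u y - if T < borelHeight ((γ₀ : (quasiSplit F E c 3).Adelic) * y) then
      borelConstantTerm ν 𝓕 u ((γ₀ : (quasiSplit F E c 3).Adelic) * y) else 0 := by
  by_cases h : T < borelHeight ((γ₀ : (quasiSplit F E c 3).Adelic) * y)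
  · rw [if_pos h, ← truncation_rational_mul ν h𝓕 T hu γ₀ y, truncation_eq_self_sub_borelConstantTerm_of_rational_invariant ν h𝓕 hu hT h, hu]
  · rw [if_neg h, sub_zero]
    exact truncation_apply_eq_self_of_forall_borelHeight_le ν 𝓕 u fun δ => (hγ₀ δ).trans (not_lt.1 h)

/-! ## §2 The pointwise limit of `(z − z₀)·Λ^T Ẽ_χ(z)` at a pole, section-dependent constant term -/

/-- **THE POINTWISE LIMIT `(z−z₀)·Λ^T Ẽ_χ(z)(y) → Fp y z₀ − 𝟙[T < H(γ₀y)]·ρψ(γ₀y)·H(γ₀y)^{2−z₀}`** (`z → z₀`, `z ≠ z₀`) for a continued family with SECTION-DEPENDENT constant term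
`Ẽ(z)_B(g) = φ(g)·H(g)^z + ψ_z(g)·H(g)^{2−z}` on `D` (`hE3`), a simple pole at `z₀` (`Fp`: `(z−z₀)Ẽ(z)(g) = Fp g z → Fp g z₀`) and the residue letter of the intertwined part
`(z−z₀)ψ_z(g) → ρψ(g)` (`hψ`): §1 at the maximiser `γ₀`, then `(z−z₀)·φ(γ₀y)H^z → 0`, `(z−z₀)ψ_z(γ₀y) → ρψ(γ₀y)`, `H^{2−z} → H^{2−z₀}`.  (Template ★ `tendsto_sub_two_mul_truncation_continued` =
the height-only case `φ ≡ φ₀`, `ψ_z ≡ φ₀·c̃(z)`, `z₀ = 2`.) [cite: MoeglinWaldspurger1995, IV.1.11] [cite: Langlands1976, §7] -/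
theorem tendsto_sub_mul_truncation_continued_of_section (ν : Measure ↥(adelicUnipotent F E c 3)) [ν.IsHaarMeasure] {𝓕 : Set ↥(adelicUnipotent F E c 3)}
    (h𝓕 : IsFundamentalDomain ↥(rationalUnipotent F E c 3) 𝓕 ν) {T : ℝ≥0} (hT : 1 ≤ T) {z₀ : ℂ}
    (Ec : ℂ → (quasiSplit F E c 3).Adelic → ℂ) {D : Set ℂ} (hD : ∀ᶠ z in 𝓝[≠] z₀, z ∈ D)
    (hEcinv : ∀ z ∈ D, ∀ (γ : (quasiSplit F E c 3).arithmeticSubgroup) (x : (quasiSplit F E c 3).Adelic), Ec z ((γ : (quasiSplit F E c 3).Adelic) * x) = Ec z x)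
    (φ : (quasiSplit F E c 3).Adelic → ℂ) (ψ : ℂ → (quasiSplit F E c 3).Adelic → ℂ) (ρψ : (quasiSplit F E c 3).Adelic → ℂ)
    (hψ : ∀ g, Tendsto (fun z : ℂ => (z - z₀) * ψ z g) (𝓝[≠] z₀) (𝓝 (ρψ g)))
    (hE3 : ∀ z ∈ D, ∀ g : (quasiSplit F E c 3).Adelic,
      borelConstantTerm ν 𝓕 (Ec z) g = φ g * (((borelHeight g : ℝ≥0) : ℝ) : ℂ) ^ z + ψ z g * (((borelHeight g : ℝ≥0) : ℝ) : ℂ) ^ (2 - z))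
    (Fp : (quasiSplit F E c 3).Adelic → ℂ → ℂ) (hF : ∀ g, AnalyticAt ℂ (Fp g) z₀) (hFE : ∀ g, Fp g =ᶠ[𝓝[≠] z₀] fun z => (z - z₀) * Ec z g)
    (y : (quasiSplit F E c 3).Adelic) (γ₀ : (quasiSplit F E c 3).arithmeticSubgroup)
    (hγ₀ : ∀ δ : (quasiSplit F E c 3).arithmeticSubgroup, borelHeight ((δ : (quasiSplit F E c 3).Adelic) * y) ≤ borelHeight ((γ₀ : (quasiSplit F E c 3).Adelic) * y)) :
    Tendsto (fun z : ℂ => (z - z₀) * truncation ν 𝓕 T (Ec z) y) (𝓝[≠] z₀)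
      (𝓝 (Fp y z₀ - if T < borelHeight ((γ₀ : (quasiSplit F E c 3).Adelic) * y) then
        ρψ ((γ₀ : (quasiSplit F E c 3).Adelic) * y) * (((borelHeight ((γ₀ : (quasiSplit F E c 3).Adelic) * y) : ℝ≥0) : ℝ) : ℂ) ^ (2 - z₀) else 0)) := by
  set y₀ : (quasiSplit F E c 3).Adelic := (γ₀ : (quasiSplit F E c 3).Adelic) * y with hy₀
  set W : ℝ≥0 := borelHeight y₀ with hWdef
  -- the Siegel-top formula along the filter
  have heq : (fun z : ℂ => (z - z₀) * truncation ν 𝓕 T (Ec z) y) =ᶠ[𝓝[≠] z₀] fun z =>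
      Fp y z - if T < W then φ y₀ * ((z - z₀) * (((W : ℝ≥0) : ℝ) : ℂ) ^ z) + ((z - z₀) * ψ z y₀) * (((W : ℝ≥0) : ℝ) : ℂ) ^ (2 - z) else 0 := by
    filter_upwards [hD, hFE y] with z hzD hzF
    rw [truncation_apply_of_isMax ν h𝓕 hT (hEcinv z hzD) y γ₀ hγ₀, ← hy₀, ← hWdef, hE3 z hzD y₀, ← hWdef, hzF, mul_sub]
    congr 1
    split_ifs
    · ring
    · rw [mul_zero]
  refine Tendsto.congr' heq.symm ?_
  have hF0 : Tendsto (Fp y) (𝓝[≠] z₀) (𝓝 (Fp y z₀)) := tendsto_nhdsWithin_of_tendsto_nhds (hF y).continuousAt.tendsto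
  refine hF0.sub ?_
  split_ifs with hTW
  · -- `W > T ≥ 1 > 0`
    have hW0 : (((W : ℝ≥0) : ℝ) : ℂ) ≠ 0 := by
      have : (0 : ℝ≥0) < W := lt_of_lt_of_le (zero_lt_one.trans_le hT) hTW.le
      exact_mod_cast this.ne'
    have hcpow : ContinuousAt (fun z : ℂ => (((W : ℝ≥0) : ℝ) : ℂ) ^ z) z₀ := continuousAt_const_cpow hW0
    have h1 : Tendsto (fun z : ℂ => φ y₀ * ((z - z₀) * (((W : ℝ≥0) : ℝ) : ℂ) ^ z)) (𝓝[≠] z₀) (𝓝 (φ y₀ * (0 * (((W : ℝ≥0) : ℝ) : ℂ) ^ z₀))) := by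
      refine tendsto_nhdsWithin_of_tendsto_nhds (Tendsto.const_mul (φ y₀) (Tendsto.mul ?_ hcpow.tendsto))
      have : Tendsto (fun z : ℂ => z - z₀) (𝓝 z₀) (𝓝 (z₀ - z₀)) := tendsto_id.sub tendsto_const_nhds
      rwa [sub_self] at this
    have h2 : Tendsto (fun z : ℂ => ((z - z₀) * ψ z y₀) * (((W : ℝ≥0) : ℝ) : ℂ) ^ (2 - z)) (𝓝[≠] z₀) (𝓝 (ρψ y₀ * (((W : ℝ≥0) : ℝ) : ℂ) ^ (2 - z₀))) := by
      refine (hψ y₀).mul (tendsto_nhdsWithin_of_tendsto_nhds ?_)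
      exact ((continuousAt_const_cpow hW0).comp_of_eq (continuousAt_const.sub continuousAt_id) rfl).tendsto
    have h := h1.add h2
    simp only [zero_mul, mul_zero, zero_add] at h
    exact h
  · exact tendsto_const_nhds

/-! ## §3 The `L²` residue class is the residue function minus the section tail, almost everywhere -/

/-- **`Res_T =ᵐ r − tail_T`**: if the operator road's `L²(μ)`-valued family `F_T(z) =ᵐ Λ^T Ẽ_χ(z)` on `D` has `(z−z₀)•F_T(z) → Res_T` in `L²(μ)` (`z → z₀`, `z ≠ z₀`), then for `μ`-a.e.
`x = [g]`, with `ỹ = g̃⁻¹` the representative and `γ₀` a maximiser SELECTOR (`hγ₀`): `Res_T(x) = Fp ỹ z₀ − 𝟙[T < w₁(x)]·ρψ(γ₀(ỹ)ỹ)·H(γ₀(ỹ)ỹ)^{2−z₀}` — an `L²` limit is an a.e. limit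
along a sequence (Mathlib `tendstoInMeasure_of_tendsto_Lp`, `TendstoInMeasure.exists_seq_tendsto_ae'`), the pointwise limit is §2, and `w₁(x) = H(γ₀(ỹ)ỹ)` (★ `supHeight_eq_ciSup_arithmetic`).
[cite: MoeglinWaldspurger1995, IV.1.11] [cite: BernsteinLapid2019, §4 p. 10] -/
theorem ae_eq_residueValue_sub_section_indicator (μ : Measure (quasiSplit F E c 3).automorphicQuotient)
    (ν : Measure ↥(adelicUnipotent F E c 3)) [ν.IsHaarMeasure] {𝓕 : Set ↥(adelicUnipotent F E c 3)}
    (h𝓕 : IsFundamentalDomain ↥(rationalUnipotent F E c 3) 𝓕 ν) {T : ℝ≥0} (hT : 1 ≤ T) {z₀ : ℂ}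
    (Ec : ℂ → (quasiSplit F E c 3).Adelic → ℂ) {D : Set ℂ} (hD : ∀ᶠ z in 𝓝[≠] z₀, z ∈ D)
    (hEcinv : ∀ z ∈ D, ∀ (γ : (quasiSplit F E c 3).arithmeticSubgroup) (x : (quasiSplit F E c 3).Adelic), Ec z ((γ : (quasiSplit F E c 3).Adelic) * x) = Ec z x)
    (φ : (quasiSplit F E c 3).Adelic → ℂ) (ψ : ℂ → (quasiSplit F E c 3).Adelic → ℂ) (ρψ : (quasiSplit F E c 3).Adelic → ℂ)
    (hψ : ∀ g, Tendsto (fun z : ℂ => (z - z₀) * ψ z g) (𝓝[≠] z₀) (𝓝 (ρψ g)))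
    (hE3 : ∀ z ∈ D, ∀ g : (quasiSplit F E c 3).Adelic,
      borelConstantTerm ν 𝓕 (Ec z) g = φ g * (((borelHeight g : ℝ≥0) : ℝ) : ℂ) ^ z + ψ z g * (((borelHeight g : ℝ≥0) : ℝ) : ℂ) ^ (2 - z))
    (Fp : (quasiSplit F E c 3).Adelic → ℂ → ℂ) (hF : ∀ g, AnalyticAt ℂ (Fp g) z₀) (hFE : ∀ g, Fp g =ᶠ[𝓝[≠] z₀] fun z => (z - z₀) * Ec z g)
    (γ₀ : (quasiSplit F E c 3).Adelic → (quasiSplit F E c 3).arithmeticSubgroup)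
    (hγ₀ : ∀ (y : (quasiSplit F E c 3).Adelic) (δ : (quasiSplit F E c 3).arithmeticSubgroup),
      borelHeight ((δ : (quasiSplit F E c 3).Adelic) * y) ≤ borelHeight ((γ₀ y : (quasiSplit F E c 3).Adelic) * y))
    (Fam : ℂ → (quasiSplit F E c 3).L2 μ)
    (hFam : ∀ z ∈ D, ((Fam z : (quasiSplit F E c 3).L2 μ) : (quasiSplit F E c 3).automorphicQuotient → ℂ) =ᵐ[μ] (quasiSplit F E c 3).quotFun (truncation ν 𝓕 T (Ec z)))
    (Res : (quasiSplit F E c 3).L2 μ) (hRes : Tendsto (fun z : ℂ => (z - z₀) • Fam z) (𝓝[≠] z₀) (𝓝 Res)) :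
    ((Res : (quasiSplit F E c 3).L2 μ) : (quasiSplit F E c 3).automorphicQuotient → ℂ) =ᵐ[μ] fun x =>
      Fp (Quotient.out (x : (quasiSplit F E c 3).Adelic ⧸ (quasiSplit F E c 3).quotientSubgroup))⁻¹ z₀ -
        if T < supHeight F E c 3 x then
          ρψ ((γ₀ (Quotient.out (x : (quasiSplit F E c 3).Adelic ⧸ (quasiSplit F E c 3).quotientSubgroup))⁻¹ : (quasiSplit F E c 3).Adelic) *
              (Quotient.out (x : (quasiSplit F E c 3).Adelic ⧸ (quasiSplit F E c 3).quotientSubgroup))⁻¹) *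
            (((borelHeight ((γ₀ (Quotient.out (x : (quasiSplit F E c 3).Adelic ⧸ (quasiSplit F E c 3).quotientSubgroup))⁻¹ : (quasiSplit F E c 3).Adelic) *
              (Quotient.out (x : (quasiSplit F E c 3).Adelic ⧸ (quasiSplit F E c 3).quotientSubgroup))⁻¹) : ℝ≥0) : ℝ) : ℂ) ^ (2 - z₀)
        else 0 := by
  -- an a.e.-convergent sequence `zₙ → z₀`, `zₙ ≠ z₀`
  have hIM := tendstoInMeasure_of_tendsto_Lp hRes
  obtain ⟨ns, hns, hae⟩ := hIM.exists_seq_tendsto_ae'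
  have hnsD : ∀ᶠ n in atTop, ns n ∈ D := hns.eventually hD
  have hrep : ∀ᵐ x ∂μ, ∀ n, ns n ∈ D → (((ns n - z₀) • Fam (ns n) : (quasiSplit F E c 3).L2 μ) : (quasiSplit F E c 3).automorphicQuotient → ℂ) x =
      (ns n - z₀) * (quasiSplit F E c 3).quotFun (truncation ν 𝓕 T (Ec (ns n))) x := by
    rw [ae_all_iff]
    intro n
    by_cases hn : ns n ∈ D
    · filter_upwards [Lp.coeFn_smul (ns n - z₀) (Fam (ns n)), hFam (ns n) hn] with x hx hx'
      intro _
      rw [hx, Pi.smul_apply, hx', smul_eq_mul]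
    · exact ae_of_all _ fun x h => absurd h hn
  filter_upwards [hae, hrep] with x hx hxrep
  set y : (quasiSplit F E c 3).Adelic := (Quotient.out (x : (quasiSplit F E c 3).Adelic ⧸ (quasiSplit F E c 3).quotientSubgroup))⁻¹ with hy
  -- the pointwise limit along the sequence (§2 at the maximiser `γ₀ y`, composed with `ns`)
  have hpt := (tendsto_sub_mul_truncation_continued_of_section ν h𝓕 hT Ec hD hEcinv φ ψ ρψ hψ hE3 Fp hF hFE y (γ₀ y) (hγ₀ y)).comp hns
  -- `w₁(x) = max_γ H(γ y) = H(γ₀(y) y)`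
  have hW : borelHeight ((γ₀ y : (quasiSplit F E c 3).Adelic) * y) = supHeight F E c 3 x := by
    rw [supHeight_eq_ciSup_arithmetic, ← hy]
    exact le_antisymm (le_ciSup (bddAbove_range_borelHeight_arith_mul y) (γ₀ y)) (ciSup_le (hγ₀ y))
  have hev : (fun n => (((ns n - z₀) • Fam (ns n) : (quasiSplit F E c 3).L2 μ) : (quasiSplit F E c 3).automorphicQuotient → ℂ) x) =ᶠ[atTop]
      ((fun z : ℂ => (z - z₀) * truncation ν 𝓕 T (Ec z) y) ∘ ns) := by
    filter_upwards [hnsD] with n hn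
    rw [hxrep n hn]
    rfl
  have hlim := tendsto_nhds_unique (hx.congr' hev) hpt
  rw [hlim, hW]

/-- **THE `hId` SPELLING `quotFun r =ᵐ Res_T + tail_T`** (R90-C133-p02's binder; `r g := Fp g z₀`, `quotFun r x = Fp x̃⁻¹ z₀` by `rfl`). [cite: MoeglinWaldspurger1995, IV.1.11] -/
theorem quotFun_residue_ae_eq_add_tail (μ : Measure (quasiSplit F E c 3).automorphicQuotient)
    (ν : Measure ↥(adelicUnipotent F E c 3)) [ν.IsHaarMeasure] {𝓕 : Set ↥(adelicUnipotent F E c 3)}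
    (h𝓕 : IsFundamentalDomain ↥(rationalUnipotent F E c 3) 𝓕 ν) {T : ℝ≥0} (hT : 1 ≤ T) {z₀ : ℂ}
    (Ec : ℂ → (quasiSplit F E c 3).Adelic → ℂ) {D : Set ℂ} (hD : ∀ᶠ z in 𝓝[≠] z₀, z ∈ D)
    (hEcinv : ∀ z ∈ D, ∀ (γ : (quasiSplit F E c 3).arithmeticSubgroup) (x : (quasiSplit F E c 3).Adelic), Ec z ((γ : (quasiSplit F E c 3).Adelic) * x) = Ec z x)
    (φ : (quasiSplit F E c 3).Adelic → ℂ) (ψ : ℂ → (quasiSplit F E c 3).Adelic → ℂ) (ρψ : (quasiSplit F E c 3).Adelic → ℂ)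
    (hψ : ∀ g, Tendsto (fun z : ℂ => (z - z₀) * ψ z g) (𝓝[≠] z₀) (𝓝 (ρψ g)))
    (hE3 : ∀ z ∈ D, ∀ g : (quasiSplit F E c 3).Adelic,
      borelConstantTerm ν 𝓕 (Ec z) g = φ g * (((borelHeight g : ℝ≥0) : ℝ) : ℂ) ^ z + ψ z g * (((borelHeight g : ℝ≥0) : ℝ) : ℂ) ^ (2 - z))
    (Fp : (quasiSplit F E c 3).Adelic → ℂ → ℂ) (hF : ∀ g, AnalyticAt ℂ (Fp g) z₀) (hFE : ∀ g, Fp g =ᶠ[𝓝[≠] z₀] fun z => (z - z₀) * Ec z g)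
    (γ₀ : (quasiSplit F E c 3).Adelic → (quasiSplit F E c 3).arithmeticSubgroup)
    (hγ₀ : ∀ (y : (quasiSplit F E c 3).Adelic) (δ : (quasiSplit F E c 3).arithmeticSubgroup),
      borelHeight ((δ : (quasiSplit F E c 3).Adelic) * y) ≤ borelHeight ((γ₀ y : (quasiSplit F E c 3).Adelic) * y))
    (Fam : ℂ → (quasiSplit F E c 3).L2 μ)
    (hFam : ∀ z ∈ D, ((Fam z : (quasiSplit F E c 3).L2 μ) : (quasiSplit F E c 3).automorphicQuotient → ℂ) =ᵐ[μ] (quasiSplit F E c 3).quotFun (truncation ν 𝓕 T (Ec z)))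
    (Res : (quasiSplit F E c 3).L2 μ) (hRes : Tendsto (fun z : ℂ => (z - z₀) • Fam z) (𝓝[≠] z₀) (𝓝 Res)) :
    (quasiSplit F E c 3).quotFun (fun g => Fp g z₀) =ᵐ[μ] fun x =>
      ((Res : (quasiSplit F E c 3).L2 μ) : (quasiSplit F E c 3).automorphicQuotient → ℂ) x +
        if T < supHeight F E c 3 x then
          ρψ ((γ₀ (Quotient.out (x : (quasiSplit F E c 3).Adelic ⧸ (quasiSplit F E c 3).quotientSubgroup))⁻¹ : (quasiSplit F E c 3).Adelic) *
              (Quotient.out (x : (quasiSplit F E c 3).Adelic ⧸ (quasiSplit F E c 3).quotientSubgroup))⁻¹) *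
            (((borelHeight ((γ₀ (Quotient.out (x : (quasiSplit F E c 3).Adelic ⧸ (quasiSplit F E c 3).quotientSubgroup))⁻¹ : (quasiSplit F E c 3).Adelic) *
              (Quotient.out (x : (quasiSplit F E c 3).Adelic ⧸ (quasiSplit F E c 3).quotientSubgroup))⁻¹) : ℝ≥0) : ℝ) : ℂ) ^ (2 - z₀)
        else 0 := by
  filter_upwards [ae_eq_residueValue_sub_section_indicator μ ν h𝓕 hT Ec hD hEcinv φ ψ ρψ hψ hE3 Fp hF hFE γ₀ hγ₀ Fam hFam Res hRes] with x hx
  rw [hx, sub_add_cancel]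
  rfl

/-! ## §4 T-hr2-2 «of letters»: the `L²` residue of the truncated χ-family exists, from the Maass–Selberg bound at the pole -/

/-- **THE `L²` RESIDUE CLASS OF THE TRUNCATED χ-EISENSTEIN FAMILY OF `U(J₃)` AT A POLE `z₀` EXISTS AND IS `r − tail_T` A.E.** (T-hr2-2 MODULO the Maass–Selberg bound): for the operator
road's `F_T : ℂ → L²(μ)`, holomorphic on an open `D` punctured-near `z₀` with `F_T(z) =ᵐ Λ^T Ẽ_χ(z)`, the bound `hMS : ‖(z − z₀)•F_T z‖ ≤ C` near `z₀` gives `Res_T := lim (z − z₀)•F_T(z)`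
(★ Banach brick `exists_tendsto_sub_smul_of_differentiableOn`, Riemann's removable singularity), and §3 identifies it.  Its two outputs are R90-C133-p02's letters `hRes` (`Res_T ∈ L²`, here an
`Lp` element) and `hId`. [cite: MoeglinWaldspurger1995, IV.1.9–IV.1.11] [cite: BernsteinLapid2019, §4 p. 10] -/
theorem exists_L2Residue_of_section (μ : Measure (quasiSplit F E c 3).automorphicQuotient)
    (ν : Measure ↥(adelicUnipotent F E c 3)) [ν.IsHaarMeasure] {𝓕 : Set ↥(adelicUnipotent F E c 3)}
    (h𝓕 : IsFundamentalDomain ↥(rationalUnipotent F E c 3) 𝓕 ν) {T : ℝ≥0} (hT : 1 ≤ T) {z₀ : ℂ}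
    (Ec : ℂ → (quasiSplit F E c 3).Adelic → ℂ) {D : Set ℂ} (hDo : IsOpen D) (hD : ∀ᶠ z in 𝓝[≠] z₀, z ∈ D)
    (hEcinv : ∀ z ∈ D, ∀ (γ : (quasiSplit F E c 3).arithmeticSubgroup) (x : (quasiSplit F E c 3).Adelic), Ec z ((γ : (quasiSplit F E c 3).Adelic) * x) = Ec z x)
    (φ : (quasiSplit F E c 3).Adelic → ℂ) (ψ : ℂ → (quasiSplit F E c 3).Adelic → ℂ) (ρψ : (quasiSplit F E c 3).Adelic → ℂ)
    (hψ : ∀ g, Tendsto (fun z : ℂ => (z - z₀) * ψ z g) (𝓝[≠] z₀) (𝓝 (ρψ g)))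
    (hE3 : ∀ z ∈ D, ∀ g : (quasiSplit F E c 3).Adelic,
      borelConstantTerm ν 𝓕 (Ec z) g = φ g * (((borelHeight g : ℝ≥0) : ℝ) : ℂ) ^ z + ψ z g * (((borelHeight g : ℝ≥0) : ℝ) : ℂ) ^ (2 - z))
    (Fp : (quasiSplit F E c 3).Adelic → ℂ → ℂ) (hF : ∀ g, AnalyticAt ℂ (Fp g) z₀) (hFE : ∀ g, Fp g =ᶠ[𝓝[≠] z₀] fun z => (z - z₀) * Ec z g)
    (γ₀ : (quasiSplit F E c 3).Adelic → (quasiSplit F E c 3).arithmeticSubgroup)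
    (hγ₀ : ∀ (y : (quasiSplit F E c 3).Adelic) (δ : (quasiSplit F E c 3).arithmeticSubgroup),
      borelHeight ((δ : (quasiSplit F E c 3).Adelic) * y) ≤ borelHeight ((γ₀ y : (quasiSplit F E c 3).Adelic) * y))
    (Fam : ℂ → (quasiSplit F E c 3).L2 μ) (hFd : DifferentiableOn ℂ Fam D)
    (hFam : ∀ z ∈ D, ((Fam z : (quasiSplit F E c 3).L2 μ) : (quasiSplit F E c 3).automorphicQuotient → ℂ) =ᵐ[μ] (quasiSplit F E c 3).quotFun (truncation ν 𝓕 T (Ec z)))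
    (hMS : ∃ C : ℝ, ∀ᶠ z in 𝓝[≠] z₀, ‖(z - z₀) • Fam z‖ ≤ C) :
    ∃ Res : (quasiSplit F E c 3).L2 μ, Tendsto (fun z : ℂ => (z - z₀) • Fam z) (𝓝[≠] z₀) (𝓝 Res) ∧
      ((Res : (quasiSplit F E c 3).L2 μ) : (quasiSplit F E c 3).automorphicQuotient → ℂ) =ᵐ[μ] fun x =>
        Fp (Quotient.out (x : (quasiSplit F E c 3).Adelic ⧸ (quasiSplit F E c 3).quotientSubgroup))⁻¹ z₀ -
          if T < supHeight F E c 3 x then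
            ρψ ((γ₀ (Quotient.out (x : (quasiSplit F E c 3).Adelic ⧸ (quasiSplit F E c 3).quotientSubgroup))⁻¹ : (quasiSplit F E c 3).Adelic) *
                (Quotient.out (x : (quasiSplit F E c 3).Adelic ⧸ (quasiSplit F E c 3).quotientSubgroup))⁻¹) *
              (((borelHeight ((γ₀ (Quotient.out (x : (quasiSplit F E c 3).Adelic ⧸ (quasiSplit F E c 3).quotientSubgroup))⁻¹ : (quasiSplit F E c 3).Adelic) *
                (Quotient.out (x : (quasiSplit F E c 3).Adelic ⧸ (quasiSplit F E c 3).quotientSubgroup))⁻¹) : ℝ≥0) : ℝ) : ℂ) ^ (2 - z₀)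
          else 0 := by
  obtain ⟨Res, hRes⟩ := exists_tendsto_sub_smul_of_differentiableOn hDo hD hFd hMS
  exact ⟨Res, hRes, ae_eq_residueValue_sub_section_indicator μ ν h𝓕 hT Ec hD hEcinv φ ψ ρψ hψ hE3 Fp hF hFE γ₀ hγ₀ Fam hFam Res hRes⟩

end Summit.HodgeConjecture.HodgeConjecture.Cruxes.H413.K2E1ChiContinuedEisensteinMiddleResidueCMThree

end
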